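import Summits.ValiantsHypothesis.ValiantsHypothesis.Theorems.MatroidMinBaseLevels
import HarnessLib

/-!
# Tight sets of a family of bases of a matroid

General matroid combinatorics ([GurjarThierauf2017, §3.2–3.3], for an ARBITRARY family of
bases); brick 2 of the UNBUILT rung 2 of the W4 road (the Gurjar–Thierauf isolation for linear
matroid intersection, made succinct).  Nothing about hitting sets, determinants, VP or VNP is
proved here; 0 S-currency.

For a matroid `M` and a family `𝓕` of bases of `M`, a set `T ⊆ M.E` is *tight* for `𝓕` if
every `B ∈ 𝓕` meets `T` in a basis of `T` (for the face of the base polytope spanned by `𝓕`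
this reads `x(T) = rk T`, [GurjarThierauf2017, §3.1]).  We prove, with neither polytopes nor
rank arithmetic:

* `tightSets M 𝓕` is a lattice of sets: it contains `∅` and `M.E` and is closed under `∩` and
  `∪` ([GurjarThierauf2017, Lemma 3.2]; `∪` is Mathlib's `Matroid.IsBasis.union_isBasis_union`,
  `∩` is the closure identity `Matroid.Indep.closure_inter_eq_inter_closure`,
  `cl (I ∩ J) = cl I ∩ cl J` for `I ∪ J` independent, [Oxley2011, §1.4]), hence under finite
  `⋂₀` and `⋃₀`; shrinking the family enlarges the lattice (`tightSets_antitone`);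
* the classes `cls M 𝓕 e = {f | every tight set contains e iff it contains f}` partition the
  ground set and refine as the family shrinks; `cls M 𝓕 e = hull M 𝓕 e \ moat M 𝓕 e` is a
  difference of two tight sets, so every class has CONSTANT TRACE on the family:
  `(B₁ ∩ cls M 𝓕 e).encard = (B₂ ∩ cls M 𝓕 e).encard` for `B₁, B₂ ∈ 𝓕`
  ([GurjarThierauf2017, Lemma 3.3]: the input of the exchange-cycle Lemma 3.7);
* an element used by no member, or by every member, of `𝓕` is a singleton class
  ([GurjarThierauf2017, Lemma 3.4]);
* bridge to `MatroidMinBaseLevels`: for `𝓕 = minBases M w`, the minimum-`w`-weight bases,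
  every level set of `w` is tight (`forall_isBasis_levelSet_of_min`), so `w` is constant on
  every class (`weight_eq_of_forall_tight_iff`).
-/

set_option linter.dupNamespace false

namespace Summit.ValiantsHypothesis.ValiantsHypothesis.Theorems.MatroidTightSets

open Matroid Summit.ValiantsHypothesis.ValiantsHypothesis.Theorems.MatroidMinBaseLevels

variable {α : Type*}

/-! ## §1 Tight sets form a ring of sets -/

/-- The sets tight for the family `𝓕`: subsets of the ground set met by every member of `𝓕`
in a basis. -/
def tightSets (M : Matroid α) (𝓕 : Set (Set α)) : Set (Set α) :=
  {T | T ⊆ M.E ∧ ∀ B ∈ 𝓕, M.IsBasis (B ∩ T) T}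

variable {M : Matroid α} {𝓕 : Set (Set α)}

/-- Unfolding lemma for `tightSets`. -/
theorem mem_tightSets_iff {T : Set α} :
    T ∈ tightSets M 𝓕 ↔ T ⊆ M.E ∧ ∀ B ∈ 𝓕, M.IsBasis (B ∩ T) T := Iff.rfl

/-- Shrinking the family enlarges the ring of tight sets. -/
theorem tightSets_antitone {𝓖 : Set (Set α)} (h : 𝓕 ⊆ 𝓖) : tightSets M 𝓖 ⊆ tightSets M 𝓕 :=
  fun _ hT => ⟨hT.1, fun B hB => hT.2 B (h hB)⟩

/-- The empty set is tight. -/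
theorem empty_mem_tightSets : (∅ : Set α) ∈ tightSets M 𝓕 :=
  ⟨Set.empty_subset _, fun B _ => by rw [Set.inter_empty]; exact M.empty_indep.isBasis_self⟩

/-- The ground set is tight for a family of bases. -/
theorem ground_mem_tightSets (h𝓕 : ∀ B ∈ 𝓕, M.IsBase B) : M.E ∈ tightSets M 𝓕 :=
  ⟨subset_rfl, fun B hB => by
    rw [Set.inter_eq_self_of_subset_left (h𝓕 B hB).subset_ground]
    exact (h𝓕 B hB).isBasis_ground⟩

/-- Tight sets are closed under intersection (via `cl (I ∩ J) = cl I ∩ cl J` for `I ∪ J ⊆ B`). -/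
theorem inter_mem_tightSets (h𝓕 : ∀ B ∈ 𝓕, M.IsBase B) {S T : Set α}
    (hS : S ∈ tightSets M 𝓕) (hT : T ∈ tightSets M 𝓕) : S ∩ T ∈ tightSets M 𝓕 := by
  refine ⟨Set.inter_subset_left.trans hS.1, fun B hB => ?_⟩
  have hind : M.Indep (B ∩ S ∪ B ∩ T) :=
    (h𝓕 B hB).indep.subset (Set.union_subset Set.inter_subset_left Set.inter_subset_left)
  have heq : B ∩ S ∩ (B ∩ T) = B ∩ (S ∩ T) := by
    ext x; simp only [Set.mem_inter_iff]; tauto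
  refine ((h𝓕 B hB).indep.inter_right _).isBasis_of_subset_of_subset_closure
    Set.inter_subset_right ?_
  rw [← heq, hind.closure_inter_eq_inter_closure]
  exact Set.inter_subset_inter (hS.2 B hB).subset_closure (hT.2 B hB).subset_closure

/-- Tight sets are closed under union. -/
theorem union_mem_tightSets (h𝓕 : ∀ B ∈ 𝓕, M.IsBase B) {S T : Set α}
    (hS : S ∈ tightSets M 𝓕) (hT : T ∈ tightSets M 𝓕) : S ∪ T ∈ tightSets M 𝓕 := by
  refine ⟨Set.union_subset hS.1 hT.1, fun B hB => ?_⟩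
  have h := (hS.2 B hB).union_isBasis_union (hT.2 B hB)
    ((h𝓕 B hB).indep.subset (Set.union_subset Set.inter_subset_left Set.inter_subset_left))
  rwa [← Set.inter_union_distrib_left] at h

/-- Finite intersections of tight sets, cut with the ground set, are tight. -/
theorem ground_inter_sInter_mem_tightSets (h𝓕 : ∀ B ∈ 𝓕, M.IsBase B) {𝓢 : Set (Set α)}
    (h𝓢 : 𝓢.Finite) (hsub : 𝓢 ⊆ tightSets M 𝓕) : M.E ∩ ⋂₀ 𝓢 ∈ tightSets M 𝓕 := by
  induction 𝓢, h𝓢 using Set.Finite.induction_on with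
  | empty => rw [Set.sInter_empty, Set.inter_univ]; exact ground_mem_tightSets h𝓕
  | @insert T 𝓢 _ _ ih =>
    rw [Set.sInter_insert, ← Set.inter_assoc, Set.inter_comm M.E T, Set.inter_assoc]
    exact inter_mem_tightSets h𝓕 (hsub (Set.mem_insert _ _))
      (ih fun S hS => hsub (Set.mem_insert_of_mem _ hS))

/-- Finite unions of tight sets are tight. -/
theorem sUnion_mem_tightSets (h𝓕 : ∀ B ∈ 𝓕, M.IsBase B) {𝓢 : Set (Set α)}
    (h𝓢 : 𝓢.Finite) (hsub : 𝓢 ⊆ tightSets M 𝓕) : ⋃₀ 𝓢 ∈ tightSets M 𝓕 := by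
  induction 𝓢, h𝓢 using Set.Finite.induction_on with
  | empty => rw [Set.sUnion_empty]; exact empty_mem_tightSets
  | @insert T 𝓢 _ _ ih =>
    rw [Set.sUnion_insert]
    exact union_mem_tightSets h𝓕 (hsub (Set.mem_insert _ _))
      (ih fun S hS => hsub (Set.mem_insert_of_mem _ hS))

/-! ## §2 Classes: the partition cut out by the tight sets -/

/-- The class of `e`: the elements that no tight set separates from `e`. -/
def cls (M : Matroid α) (𝓕 : Set (Set α)) (e : α) : Set α :=
  {f | ∀ T ∈ tightSets M 𝓕, (e ∈ T ↔ f ∈ T)}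

/-- The hull of `e`: the ground set cut with every tight set containing `e`. -/
def hull (M : Matroid α) (𝓕 : Set (Set α)) (e : α) : Set α :=
  M.E ∩ ⋂₀ {T | T ∈ tightSets M 𝓕 ∧ e ∈ T}

/-- The moat of `e`: the union of the tight sets avoiding `e`. -/
def moat (M : Matroid α) (𝓕 : Set (Set α)) (e : α) : Set α :=
  ⋃₀ {T | T ∈ tightSets M 𝓕 ∧ e ∉ T}

/-- Unfolding lemma for `cls`. -/
theorem mem_cls_iff {e f : α} :
    f ∈ cls M 𝓕 e ↔ ∀ T ∈ tightSets M 𝓕, (e ∈ T ↔ f ∈ T) := Iff.rfl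

/-- Every element lies in its own class. -/
theorem mem_cls_self (e : α) : e ∈ cls M 𝓕 e := fun _ _ => Iff.rfl

/-- The class relation is symmetric. -/
theorem mem_cls_comm {e f : α} : f ∈ cls M 𝓕 e ↔ e ∈ cls M 𝓕 f :=
  ⟨fun h T hT => (h T hT).symm, fun h T hT => (h T hT).symm⟩

/-- The class relation is transitive: classes of related elements coincide. -/
theorem cls_eq_cls_of_mem {e f : α} (h : f ∈ cls M 𝓕 e) : cls M 𝓕 f = cls M 𝓕 e := by
  ext g
  exact ⟨fun hg T hT => (h T hT).trans (hg T hT), fun hg T hT => (h T hT).symm.trans (hg T hT)⟩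

/-- Classes of ground-set elements stay inside the ground set. -/
theorem cls_subset_ground (h𝓕 : ∀ B ∈ 𝓕, M.IsBase B) {e : α} (he : e ∈ M.E) :
    cls M 𝓕 e ⊆ M.E :=
  fun _ hf => (hf _ (ground_mem_tightSets h𝓕)).1 he

/-- Shrinking the family refines the classes. -/
theorem cls_mono {𝓖 : Set (Set α)} (h : 𝓕 ⊆ 𝓖) (e : α) : cls M 𝓕 e ⊆ cls M 𝓖 e :=
  fun _ hf T hT => hf T (tightSets_antitone h hT)

/-- `e` lies in its hull. -/
theorem mem_hull {e : α} (he : e ∈ M.E) : e ∈ hull M 𝓕 e :=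
  ⟨he, Set.mem_sInter.2 fun _ hT => hT.2⟩

/-- `e` avoids its moat. -/
theorem not_mem_moat (e : α) : e ∉ moat M 𝓕 e := fun h => by
  obtain ⟨T, hT, heT⟩ := Set.mem_sUnion.1 h
  exact hT.2 heT

/-- Half of the class formula, valid without finiteness: `hull \ moat ⊆ cls`. -/
theorem hull_diff_moat_subset_cls (e : α) : hull M 𝓕 e \ moat M 𝓕 e ⊆ cls M 𝓕 e := by
  rintro f ⟨hfh, hfm⟩ T hT
  refine ⟨fun heT => Set.mem_sInter.1 hfh.2 T ⟨hT, heT⟩, fun hfT => ?_⟩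
  by_contra heT
  exact hfm (Set.mem_sUnion.2 ⟨T, ⟨hT, heT⟩, hfT⟩)

/-! ## §3 Singleton classes ([GurjarThierauf2017, Lemma 3.4]) -/

/-- If no member of the family uses `e`, the ground set minus `e` is tight. -/
theorem ground_diff_singleton_mem_tightSets (h𝓕 : ∀ B ∈ 𝓕, M.IsBase B) {e : α}
    (hun : ∀ B ∈ 𝓕, e ∉ B) : M.E \ {e} ∈ tightSets M 𝓕 := by
  refine ⟨Set.sdiff_subset, fun B hB => ?_⟩
  have hBsub : B ⊆ M.E \ {e} := fun x hx =>
    ⟨(h𝓕 B hB).subset_ground hx, fun hxe => hun B hB (Set.mem_singleton_iff.1 hxe ▸ hx)⟩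
  rw [Set.inter_eq_self_of_subset_left hBsub]
  exact (h𝓕 B hB).isBasis_ground.isBasis_subset hBsub Set.sdiff_subset

/-- An element of the ground set used by no member of the family is a singleton class. -/
theorem cls_eq_singleton_of_forall_not_mem (h𝓕 : ∀ B ∈ 𝓕, M.IsBase B) {e : α} (he : e ∈ M.E)
    (hun : ∀ B ∈ 𝓕, e ∉ B) : cls M 𝓕 e = {e} := by
  ext f
  simp only [Set.mem_singleton_iff]
  refine ⟨fun hf => ?_, fun h => by subst h; exact mem_cls_self _⟩
  by_contra hne
  have h := hf _ (ground_diff_singleton_mem_tightSets h𝓕 hun)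
  exact (h.2 ⟨cls_subset_ground h𝓕 he hf, fun h' => hne (Set.mem_singleton_iff.1 h')⟩).2
    (Set.mem_singleton e)

/-- If every member of the family uses `e`, the singleton `{e}` is tight. -/
theorem singleton_mem_tightSets (h𝓕 : ∀ B ∈ 𝓕, M.IsBase B) {e : α} (he : e ∈ M.E)
    (hus : ∀ B ∈ 𝓕, e ∈ B) : ({e} : Set α) ∈ tightSets M 𝓕 := by
  refine ⟨Set.singleton_subset_iff.2 he, fun B hB => ?_⟩
  rw [Set.inter_eq_self_of_subset_right (Set.singleton_subset_iff.2 (hus B hB))]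
  exact ((h𝓕 B hB).indep.subset (Set.singleton_subset_iff.2 (hus B hB))).isBasis_self

/-- An element used by every member of the family is a singleton class. -/
theorem cls_eq_singleton_of_forall_mem (h𝓕 : ∀ B ∈ 𝓕, M.IsBase B) {e : α} (he : e ∈ M.E)
    (hus : ∀ B ∈ 𝓕, e ∈ B) : cls M 𝓕 e = {e} := by
  ext f
  simp only [Set.mem_singleton_iff]
  refine ⟨fun hf => ?_, fun h => by subst h; exact mem_cls_self _⟩
  exact Set.mem_singleton_iff.1 ((hf _ (singleton_mem_tightSets h𝓕 he hus)).1
    (Set.mem_singleton e))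

/-! ## §4 Class formula and constant trace (finite ground type) -/

variable [Fintype α]

/-- The hull is tight. -/
theorem hull_mem_tightSets (h𝓕 : ∀ B ∈ 𝓕, M.IsBase B) (e : α) : hull M 𝓕 e ∈ tightSets M 𝓕 :=
  ground_inter_sInter_mem_tightSets h𝓕 (Set.toFinite _) fun _ hT => hT.1

/-- The moat is tight. -/
theorem moat_mem_tightSets (h𝓕 : ∀ B ∈ 𝓕, M.IsBase B) (e : α) : moat M 𝓕 e ∈ tightSets M 𝓕 :=
  sUnion_mem_tightSets h𝓕 (Set.toFinite _) fun _ hT => hT.1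

/-- CLASS FORMULA: the class of `e ∈ M.E` is its hull minus its moat. -/
theorem cls_eq_hull_diff_moat (h𝓕 : ∀ B ∈ 𝓕, M.IsBase B) {e : α} (he : e ∈ M.E) :
    cls M 𝓕 e = hull M 𝓕 e \ moat M 𝓕 e := by
  refine Set.Subset.antisymm (fun f hf => ?_) (hull_diff_moat_subset_cls e)
  exact ⟨(hf _ (hull_mem_tightSets h𝓕 e)).1 (mem_hull he),
    fun hfm => not_mem_moat e ((hf _ (moat_mem_tightSets h𝓕 e)).2 hfm)⟩

/-- The trace of any set on a class, as a difference of its traces on two nested tight sets. -/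
theorem card_inter_cls_add (h𝓕 : ∀ B ∈ 𝓕, M.IsBase B) {e : α} (he : e ∈ M.E) (B : Set α) :
    (fs (B ∩ cls M 𝓕 e)).card + (fs (B ∩ (hull M 𝓕 e ∩ moat M 𝓕 e))).card =
      (fs (B ∩ hull M 𝓕 e)).card := by
  have hset : B ∩ (hull M 𝓕 e \ moat M 𝓕 e) =
      (B ∩ hull M 𝓕 e) \ (B ∩ (hull M 𝓕 e ∩ moat M 𝓕 e)) := by
    ext x; simp only [Set.mem_inter_iff, Set.mem_sdiff]; tauto
  have h : (B ∩ cls M 𝓕 e).encard + (B ∩ (hull M 𝓕 e ∩ moat M 𝓕 e)).encard =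
      (B ∩ hull M 𝓕 e).encard := by
    rw [cls_eq_hull_diff_moat h𝓕 he, hset]
    exact Set.encard_sdiff_add_encard_of_subset fun x hx => ⟨hx.1, hx.2.1⟩
  rw [encard_eq_card_fs, encard_eq_card_fs, encard_eq_card_fs] at h
  exact_mod_cast h

/-- CONSTANT TRACE ([GurjarThierauf2017, Lemma 3.3]): all members of the family meet a class
in the same number of elements. -/
theorem encard_inter_cls_eq (h𝓕 : ∀ B ∈ 𝓕, M.IsBase B) {e : α} (he : e ∈ M.E)
    {B₁ B₂ : Set α} (hB₁ : B₁ ∈ 𝓕) (hB₂ : B₂ ∈ 𝓕) :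
    (B₁ ∩ cls M 𝓕 e).encard = (B₂ ∩ cls M 𝓕 e).encard := by
  have hH := hull_mem_tightSets h𝓕 e
  have hHU := inter_mem_tightSets h𝓕 hH (moat_mem_tightSets h𝓕 e)
  have k1 := card_inter_cls_add h𝓕 he B₁
  have k2 := card_inter_cls_add h𝓕 he B₂
  have c1 : (fs (B₁ ∩ hull M 𝓕 e)).card = (fs (B₂ ∩ hull M 𝓕 e)).card :=
    card_fs_eq_card_fs (((hH.2 B₁ hB₁).encard_eq_eRk).trans (hH.2 B₂ hB₂).encard_eq_eRk.symm)
  have c2 : (fs (B₁ ∩ (hull M 𝓕 e ∩ moat M 𝓕 e))).card =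
      (fs (B₂ ∩ (hull M 𝓕 e ∩ moat M 𝓕 e))).card :=
    card_fs_eq_card_fs
      (((hHU.2 B₁ hB₁).encard_eq_eRk).trans (hHU.2 B₂ hB₂).encard_eq_eRk.symm)
  rw [encard_eq_card_fs, encard_eq_card_fs]
  exact_mod_cast (by omega : (fs (B₁ ∩ cls M 𝓕 e)).card = (fs (B₂ ∩ cls M 𝓕 e)).card)

/-! ## §5 Bridge: minimum-weight bases -/

/-- The family of minimum-`w`-weight bases of `M`. -/
def minBases (M : Matroid α) (w : α → ℕ) : Set (Set α) :=
  {B | M.IsBase B ∧ ∀ B', M.IsBase B' → wt w B ≤ wt w B'}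

variable {w : α → ℕ}

/-- Members of `minBases` are bases. -/
theorem isBase_of_mem_minBases : ∀ B ∈ minBases M w, M.IsBase B := fun _ hB => hB.1

/-- `minBases` is nonempty. -/
theorem minBases_nonempty (M : Matroid α) (w : α → ℕ) : (minBases M w).Nonempty :=
  exists_min_isBase M w

/-- Every level set of `w` is tight for the minimum-`w`-weight bases
(`MatroidMinBaseLevels.forall_isBasis_levelSet_of_min`). -/
theorem levelSet_mem_tightSets_minBases (θ : ℕ) :
    levelSet M w θ ∈ tightSets M (minBases M w) :=
  ⟨levelSet_subset_ground M w θ, fun _ hB => forall_isBasis_levelSet_of_min hB.1 hB.2 θ⟩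

/-- `w` is constant on every class of the minimum-`w`-weight bases (by
`MatroidMinBaseLevels.weight_eq_of_forall_tight_iff`; [GurjarThierauf2017, Lemma 3.9],
step (b) of the minimising-face version). -/
theorem weight_eq_of_mem_cls_minBases {e f : α} (he : e ∈ M.E)
    (hf : f ∈ cls M (minBases M w) e) : w f = w e :=
  (weight_eq_of_forall_tight_iff he (cls_subset_ground isBase_of_mem_minBases he hf)
    fun T hT htight => hf T ⟨hT, fun B hB => htight B hB.1 hB.2⟩).symm

end Summit.ValiantsHypothesis.ValiantsHypothesis.Theorems.MatroidTightSets
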